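import Summits.HodgeConjecture.HodgeConjecture.Theorems.K2LiuSplitSliceOfTorusDecay   -- ★ p857141 (K2Liu-p05): the #32d slice frame, (A)(T1)(T2), ★ H5

/-!
# The finite slice of #32d ∕ #32dR at a place where `G_v = U(H)(L⁺_v)` is COMPACT (organ (NS-c) of (Bv-nonsplit))

Track B ∕ K2-LIT, hLiu418 = stmt-HodgeConjecture-24832; socket #32dR `sig_K2LiuDoublingHeightDecayLocalR2` of
`Cruxes/HLiu418/Lines/K2_Liu_CurveThetaSigs_U5d_ZetaS.lean` (ED. 5 :554) through ★ (R) `K2LiuDoublingHeightDecayLocalOfSlices.doublingHeightDecayLocal_of_slices`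
(p856795) and ★ `K2LiuDoublingHeightDecayLocalR2OfFinSlices` (K2Liu-p02): #32dR follows from the integrability of the finite slices
`u ↦ Φ(ι(ιA placesEmbed_S(1, u at v), 1))^τ`, `v ∈ S`.  LEAD F0P6-plan (g11) M-155c (2) (2026-09-04): organ (Bv-nonsplit) → K2Liu-p04 (g3);
REPORT-FIRST `K2/K2Liu-p04/g3/REPORT-FIRST-32dR-BvNonsplit.K2Liup04g3.md`.  THIS FILE = case (NS-c): at a finite place `v ∈ S` that is NON-SPLIT in `L`
with `V_v = (L_w², H)` ANISOTROPIC the group `G_v` is compact, and then the slice — a continuous function on a compact group, integrated against a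
Haar (hence finite) measure — is integrable for EVERY real exponent `τ`, with no decay estimate at all.  We state it for any `N`, any `H` in the frame
of ★ (R) (pinned `ιA`), under the hypothesis `CompactSpace G_v` (resp. `IsCompact univ`); the supplier «`V_v` anisotropic ⇒ `G_v` compact» is organ (AN).
Continuity of the slice: ★ H5 `exists_continuousMulEquiv_eq_iotaA` (`ιA` is a `≃ₜ*`), ★ `continuous_iotaLeft`, ★ `continuous_placesEmbed`, as in ★ (R)
and ★ `K2LiuSplitSliceOfTorusDecay`.  Theorems only; no `sorry`; default heartbeats.
[GelbartPiatetskishapiroRallis1987, Part A §6]; [Li1992, §3 Thm. 3.1]; [Liu2011, §2C p. 863]; [PlatonovRapinchuk1994, §3.3].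
HONEST LABEL: HC_CM is proved only modulo the 7 printed citations (2 remaining named inputs: hLiu418 = stmt-HodgeConjecture-24832, h413 =
stmt-HodgeConjecture-24833) until rung 0 closes; count-neutral helper toward #32dR, retires nothing by itself.
-/

set_option autoImplicit false
-- the mandated namespace repeats the single-problem summit's segment (`HodgeConjecture.HodgeConjecture`)
set_option linter.dupNamespace false

noncomputable section

open scoped Matrix
open NumberField IsDedekindDomain MeasureTheory

namespace Summit.HodgeConjecture.HodgeConjecture.Cruxes.HLiu418.K2LiuNonsplitSliceCompact

open Literature.NumberTheory.Automorphic Literature.NumberTheory.Automorphic.UnitaryGroup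
open Literature.NumberTheory.GelbartRogawski1991 Literature.NumberTheory.GelbartRogawski1991.GRConstruction
open Literature.NumberTheory.K2Lit.SiegelDoubled Literature.NumberTheory.K2Lit.PlaceSplitting
open Summit.HodgeConjecture.HodgeConjecture.Cruxes.HLiu418.K2LiuDoublingUnfoldBridge

variable (L : Type) [Field L] [NumberField L] [IsCMField L]
variable {N M n : ℕ} (e : Fin N × Fin M ≃ Fin n)
  (dV : Fin N → L) (hdV : ∀ i, IsCMField.complexConj L (dV i) = dV i)
  (dW : Fin M → L) (hdW : ∀ i, IsCMField.complexConj L (dW i) = dW i)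
  (H : Matrix (Fin N) (Fin N) L) (t : L) (ht : t ≠ 0) (g : GL (Fin N) L)
  (hg : formCongr ((IsCMField.complexConj L : L ≃ₐ[↥(maximalRealSubfield L)] L) : L →+* L) g (t • H) = Matrix.diagonal dV)
  (ιA : (UnitaryGroup.adelicGroupData (Fp L) L (IsCMField.complexConj L) N H).Adelic →*
    UnitaryGroup.adelic (Fp L) L (IsCMField.complexConj L) N (Matrix.diagonal dV))
  (hιA : ∀ k, ((ιA k : ↥(UnitaryGroup.adelic (Fp L) L (IsCMField.complexConj L) N (Matrix.diagonal dV))) :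
        GL (Fin N) (AdeleRing (𝓞 L) L)) =
      (toAdeleGL L g)⁻¹ * UnitaryGroup.adelicVal (Fp L) L (IsCMField.complexConj L) N H k * toAdeleGL L g)
  (S : Finset (HeightOneSpectrum (𝓞 (Fp L)))) [DecidableEq (HeightOneSpectrum (𝓞 (Fp L)))]

include ht hg hιA in
/-- **the slice is continuous**: `u ↦ ι(ιA placesEmbed_S(1, u at v), 1)` is a continuous map `G_v → H(𝔸)` (★ H5: `ιA` is a `≃ₜ*`; ★ `continuous_iotaLeft`;
★ `continuous_placesEmbed`; `Pi.mulSingle v` is continuous). [cite: PlatonovRapinchuk1994, §5.1] [cite: HarrisKudlaSweet1996, §1 (1.11)] -/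
theorem continuous_placeSlice (v : S) :
    Continuous fun u : UnitaryGroup.localPi L (IsCMField.complexConj L) N H v.1 =>
      iotaLeft L e dV hdV dW hdW (ιA (placesEmbed L H S (1, Pi.mulSingle v u))) := by
  obtain ⟨Ψ, -, hΨ⟩ := exists_continuousMulEquiv_eq_iotaA L H dV t ht g hg ιA hιA
  have hιc : Continuous ιA := by
    have h : (ιA : _ → _) = Ψ := funext fun x => (hΨ x).symm
    rw [h]
    exact Ψ.continuous
  exact (continuous_iotaLeft L e dV hdV dW hdW).comp (hιc.comp ((continuous_placesEmbed L H S).comp (continuous_const.prodMk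
    (continuous_mulSingle (A := fun w : S => UnitaryGroup.localPi L (IsCMField.complexConj L) N H w.1) v))))

include ht hg hιA in
/-- **THE FINITE SLICE AT A PLACE WITH COMPACT `G_v` (case (NS-c) of (Bv-nonsplit): `V_v` anisotropic).**  For a continuous height `Φ > 0` on
`H(𝔸)`, a Haar measure `ν` on a COMPACT `G_v = U(H)(L⁺_v)` and ANY real `τ`, the slice `u ↦ Φ(ι(ιA placesEmbed_S(1, u at v), 1))^τ` is
`ν`-integrable — a continuous function on a compact space against a measure finite on compacts.  This is `_hfin v` of ★ (R)
`doublingHeightDecayLocal_of_slices` ∕ ★ `doublingHeightDecayLocalR2_of_finSlices` at such a place.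
[cite: GelbartPiatetskishapiroRallis1987, Part A §6] [cite: Li1992, §3 Thm. 3.1] [cite: PlatonovRapinchuk1994, §3.3] -/
theorem integrable_placeSlice_of_compactSpace (v : S)
    [MeasurableSpace (UnitaryGroup.localPi L (IsCMField.complexConj L) N H v.1)]
    [BorelSpace (UnitaryGroup.localPi L (IsCMField.complexConj L) N H v.1)]
    [CompactSpace (UnitaryGroup.localPi L (IsCMField.complexConj L) N H v.1)]
    (ν : Measure (UnitaryGroup.localPi L (IsCMField.complexConj L) N H v.1)) [IsFiniteMeasureOnCompacts ν]
    {Φ : HA L e dV hdV dW hdW → ℝ} (hΦc : Continuous Φ) (hΦpos : ∀ x, 0 < Φ x) (τ : ℝ) :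
    Integrable (fun u => Φ (iotaLeft L e dV hdV dW hdW (ιA (placesEmbed L H S (1, Pi.mulSingle v u)))) ^ τ) ν :=
  ((hΦc.comp (continuous_placeSlice L e dV hdV dW hdW H t ht g hg ιA hιA S v)).rpow_const fun _ =>
      Or.inl (hΦpos _).ne').integrable_of_hasCompactSupport (HasCompactSupport.of_compactSpace _)

include ht hg hιA in
/-- the same with the compactness of `G_v` as a hypothesis `IsCompact univ` (the form organ (AN) «`V_v` anisotropic ⇒ `G_v` compact» delivers) and
`ν` a Haar measure, as in socket #32dR. [cite: GelbartPiatetskishapiroRallis1987, Part A §6] [cite: PlatonovRapinchuk1994, §3.3] -/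
theorem integrable_placeSlice_of_isCompact_univ (v : S)
    [MeasurableSpace (UnitaryGroup.localPi L (IsCMField.complexConj L) N H v.1)]
    [BorelSpace (UnitaryGroup.localPi L (IsCMField.complexConj L) N H v.1)]
    (hK : IsCompact (Set.univ : Set (UnitaryGroup.localPi L (IsCMField.complexConj L) N H v.1)))
    (ν : Measure (UnitaryGroup.localPi L (IsCMField.complexConj L) N H v.1)) [ν.IsHaarMeasure]
    {Φ : HA L e dV hdV dW hdW → ℝ} (hΦc : Continuous Φ) (hΦpos : ∀ x, 0 < Φ x) (τ : ℝ) :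
    Integrable (fun u => Φ (iotaLeft L e dV hdV dW hdW (ιA (placesEmbed L H S (1, Pi.mulSingle v u)))) ^ τ) ν := by
  haveI : CompactSpace (UnitaryGroup.localPi L (IsCMField.complexConj L) N H v.1) := ⟨hK⟩
  exact integrable_placeSlice_of_compactSpace L e dV hdV dW hdW H t ht g hg ιA hιA S v ν hΦc hΦpos τ

end Summit.HodgeConjecture.HodgeConjecture.Cruxes.HLiu418.K2LiuNonsplitSliceCompact

end
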